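import Mathlib
import Summits.Ventures.PercRepro2.RootPairSep

/-!
# Root-pair separation for the TYPED bracket, (iv): restriction to the piece
(blind cell PercRepro2, mine-2 g21; proofs/MINE2-CUTU.md §10.4 Theorem 7′ (iv); the cases (i)–(iii)
are in `RootPairSepTyped.lean`, the weighted L-half version in `RootPairSepRestrict.lean`).

If the roots `a₁, a₂` separate the vertex set and `o, u, b` all lie on the side `V₁`, every
probability `P(X ∩ Q)` entering the typed bracket `β₁ = (HALF-PM⁺)_L + (HALF-PM⁺)_H + A` factorises
as `P(r₁⁻¹(X ∩ Q)) · P(r₂⁻¹ Q)`, so `β₁(G) = P(r₂⁻¹ Q)³ · β₁(G[V₁])` with every connection event of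
the piece read in the configuration restricted to the edges of `V₁`.
-/

namespace Summit.Ventures.PercRepro2

namespace RootPairSep

open SepPair

section Main

variable {V : Type*} {E : Type*} [Fintype E] [DecidableEq E] {R : Type*} [CommRing R]

/-- **Theorem 7′ (iv).**  If `o`, `u`, `b` all lie on the side `V₁`, the typed bracket `β₁` equals `P(r₂⁻¹ Q)³` times the typed bracket of the piece `G[V₁]` (every connection event read in the configuration restricted to the edges of `V₁`). -/
theorem beta1_eq_mul_restrict (p : E → R) {ends : E → Sym2 V} {a₁ a₂ : V}
    {V₁ V₂ : Set V} (hs : IsRootPairSep ends a₁ a₂ V₁ V₂) {o u b : V}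
    [DecidablePred (· ∈ side₁ ends V₁)] [DecidablePred (· ∈ (side₁ ends V₁)ᶜ)]
    (ho : o ∈ V₁) (hu : u ∈ V₁) (hb : b ∈ V₁) :
    prob p (connEvent ends a₁ a₂)ᶜ *
          (prob p (connEvent ends a₁ a₂)ᶜ * prob p (connEvent ends a₁ b ∩ connEvent ends a₂ u ∩ (connEvent ends a₁ o ∪ connEvent ends a₂ o) ∩ (connEvent ends a₁ a₂)ᶜ) -
            prob p (connEvent ends a₁ b ∩ (connEvent ends a₁ a₂)ᶜ) * prob p (connEvent ends a₂ u ∩ (connEvent ends a₁ o ∪ connEvent ends a₂ o) ∩ (connEvent ends a₁ a₂)ᶜ)) -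
        prob p ((connEvent ends a₁ o ∪ connEvent ends a₂ o) ∩ (connEvent ends a₁ a₂)ᶜ) *
          (prob p (connEvent ends a₁ a₂)ᶜ * prob p (connEvent ends a₁ b ∩ connEvent ends a₂ u ∩ (connEvent ends a₁ a₂)ᶜ) -
            prob p (connEvent ends a₁ b ∩ (connEvent ends a₁ a₂)ᶜ) * prob p (connEvent ends a₂ u ∩ (connEvent ends a₁ a₂)ᶜ)) -
        prob p (connEvent ends a₁ a₂)ᶜ *
          (prob p (connEvent ends a₁ a₂)ᶜ * prob p (connEvent ends a₁ b ∩ connEvent ends a₂ o ∩ (connEvent ends a₁ a₂)ᶜ) -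
            prob p (connEvent ends a₁ b ∩ (connEvent ends a₁ a₂)ᶜ) * prob p (connEvent ends a₂ o ∩ (connEvent ends a₁ a₂)ᶜ)) +
        prob p (connEvent ends a₁ a₂)ᶜ *
          (prob p (connEvent ends a₁ a₂)ᶜ * prob p (connEvent ends a₂ b ∩ connEvent ends a₁ u ∩ (connEvent ends a₁ o ∪ connEvent ends a₂ o) ∩ (connEvent ends a₁ a₂)ᶜ) -
            prob p (connEvent ends a₂ b ∩ (connEvent ends a₁ a₂)ᶜ) * prob p (connEvent ends a₁ u ∩ (connEvent ends a₁ o ∪ connEvent ends a₂ o) ∩ (connEvent ends a₁ a₂)ᶜ)) -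
        prob p ((connEvent ends a₁ o ∪ connEvent ends a₂ o) ∩ (connEvent ends a₁ a₂)ᶜ) *
          (prob p (connEvent ends a₁ a₂)ᶜ * prob p (connEvent ends a₂ b ∩ connEvent ends a₁ u ∩ (connEvent ends a₁ a₂)ᶜ) -
            prob p (connEvent ends a₂ b ∩ (connEvent ends a₁ a₂)ᶜ) * prob p (connEvent ends a₁ u ∩ (connEvent ends a₁ a₂)ᶜ)) -
        prob p (connEvent ends a₁ a₂)ᶜ *
          (prob p (connEvent ends a₁ a₂)ᶜ * prob p (connEvent ends a₂ b ∩ connEvent ends a₁ o ∩ (connEvent ends a₁ a₂)ᶜ) -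
            prob p (connEvent ends a₂ b ∩ (connEvent ends a₁ a₂)ᶜ) * prob p (connEvent ends a₁ o ∩ (connEvent ends a₁ a₂)ᶜ)) +
        (prob p ((connEvent ends a₁ u ∪ connEvent ends a₂ u) ∩ (connEvent ends a₁ a₂)ᶜ) - prob p (connEvent ends a₁ a₂)ᶜ) *
          (prob p (connEvent ends a₁ a₂)ᶜ * prob p (connEvent ends a₁ b ∩ connEvent ends a₂ o ∩ (connEvent ends a₁ a₂)ᶜ) - prob p (connEvent ends a₁ b ∩ (connEvent ends a₁ a₂)ᶜ) * prob p (connEvent ends a₂ o ∩ (connEvent ends a₁ a₂)ᶜ) +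
            prob p (connEvent ends a₁ a₂)ᶜ * prob p (connEvent ends a₂ b ∩ connEvent ends a₁ o ∩ (connEvent ends a₁ a₂)ᶜ) - prob p (connEvent ends a₂ b ∩ (connEvent ends a₁ a₂)ᶜ) * prob p (connEvent ends a₁ o ∩ (connEvent ends a₁ a₂)ᶜ)) =
      prob p (restrictTo (side₁ ends V₁)ᶜ ⁻¹' (connEvent ends a₁ a₂)ᶜ) ^ 3 *
       (        prob p (restrictTo (side₁ ends V₁) ⁻¹' (connEvent ends a₁ a₂)ᶜ) *
              (prob p (restrictTo (side₁ ends V₁) ⁻¹' (connEvent ends a₁ a₂)ᶜ) * prob p (restrictTo (side₁ ends V₁) ⁻¹' connEvent ends a₁ b ∩ restrictTo (side₁ ends V₁) ⁻¹' connEvent ends a₂ u ∩ (restrictTo (side₁ ends V₁) ⁻¹' connEvent ends a₁ o ∪ restrictTo (side₁ ends V₁) ⁻¹' connEvent ends a₂ o) ∩ restrictTo (side₁ ends V₁) ⁻¹' (connEvent ends a₁ a₂)ᶜ) -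
                prob p (restrictTo (side₁ ends V₁) ⁻¹' connEvent ends a₁ b ∩ restrictTo (side₁ ends V₁) ⁻¹' (connEvent ends a₁ a₂)ᶜ) * prob p (restrictTo (side₁ ends V₁) ⁻¹' connEvent ends a₂ u ∩ (restrictTo (side₁ ends V₁) ⁻¹' connEvent ends a₁ o ∪ restrictTo (side₁ ends V₁) ⁻¹' connEvent ends a₂ o) ∩ restrictTo (side₁ ends V₁) ⁻¹' (connEvent ends a₁ a₂)ᶜ)) -
            prob p ((restrictTo (side₁ ends V₁) ⁻¹' connEvent ends a₁ o ∪ restrictTo (side₁ ends V₁) ⁻¹' connEvent ends a₂ o) ∩ restrictTo (side₁ ends V₁) ⁻¹' (connEvent ends a₁ a₂)ᶜ) *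
              (prob p (restrictTo (side₁ ends V₁) ⁻¹' (connEvent ends a₁ a₂)ᶜ) * prob p (restrictTo (side₁ ends V₁) ⁻¹' connEvent ends a₁ b ∩ restrictTo (side₁ ends V₁) ⁻¹' connEvent ends a₂ u ∩ restrictTo (side₁ ends V₁) ⁻¹' (connEvent ends a₁ a₂)ᶜ) -
                prob p (restrictTo (side₁ ends V₁) ⁻¹' connEvent ends a₁ b ∩ restrictTo (side₁ ends V₁) ⁻¹' (connEvent ends a₁ a₂)ᶜ) * prob p (restrictTo (side₁ ends V₁) ⁻¹' connEvent ends a₂ u ∩ restrictTo (side₁ ends V₁) ⁻¹' (connEvent ends a₁ a₂)ᶜ)) -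
            prob p (restrictTo (side₁ ends V₁) ⁻¹' (connEvent ends a₁ a₂)ᶜ) *
              (prob p (restrictTo (side₁ ends V₁) ⁻¹' (connEvent ends a₁ a₂)ᶜ) * prob p (restrictTo (side₁ ends V₁) ⁻¹' connEvent ends a₁ b ∩ restrictTo (side₁ ends V₁) ⁻¹' connEvent ends a₂ o ∩ restrictTo (side₁ ends V₁) ⁻¹' (connEvent ends a₁ a₂)ᶜ) -
                prob p (restrictTo (side₁ ends V₁) ⁻¹' connEvent ends a₁ b ∩ restrictTo (side₁ ends V₁) ⁻¹' (connEvent ends a₁ a₂)ᶜ) * prob p (restrictTo (side₁ ends V₁) ⁻¹' connEvent ends a₂ o ∩ restrictTo (side₁ ends V₁) ⁻¹' (connEvent ends a₁ a₂)ᶜ)) +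
            prob p (restrictTo (side₁ ends V₁) ⁻¹' (connEvent ends a₁ a₂)ᶜ) *
              (prob p (restrictTo (side₁ ends V₁) ⁻¹' (connEvent ends a₁ a₂)ᶜ) * prob p (restrictTo (side₁ ends V₁) ⁻¹' connEvent ends a₂ b ∩ restrictTo (side₁ ends V₁) ⁻¹' connEvent ends a₁ u ∩ (restrictTo (side₁ ends V₁) ⁻¹' connEvent ends a₁ o ∪ restrictTo (side₁ ends V₁) ⁻¹' connEvent ends a₂ o) ∩ restrictTo (side₁ ends V₁) ⁻¹' (connEvent ends a₁ a₂)ᶜ) -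
                prob p (restrictTo (side₁ ends V₁) ⁻¹' connEvent ends a₂ b ∩ restrictTo (side₁ ends V₁) ⁻¹' (connEvent ends a₁ a₂)ᶜ) * prob p (restrictTo (side₁ ends V₁) ⁻¹' connEvent ends a₁ u ∩ (restrictTo (side₁ ends V₁) ⁻¹' connEvent ends a₁ o ∪ restrictTo (side₁ ends V₁) ⁻¹' connEvent ends a₂ o) ∩ restrictTo (side₁ ends V₁) ⁻¹' (connEvent ends a₁ a₂)ᶜ)) -
            prob p ((restrictTo (side₁ ends V₁) ⁻¹' connEvent ends a₁ o ∪ restrictTo (side₁ ends V₁) ⁻¹' connEvent ends a₂ o) ∩ restrictTo (side₁ ends V₁) ⁻¹' (connEvent ends a₁ a₂)ᶜ) *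
              (prob p (restrictTo (side₁ ends V₁) ⁻¹' (connEvent ends a₁ a₂)ᶜ) * prob p (restrictTo (side₁ ends V₁) ⁻¹' connEvent ends a₂ b ∩ restrictTo (side₁ ends V₁) ⁻¹' connEvent ends a₁ u ∩ restrictTo (side₁ ends V₁) ⁻¹' (connEvent ends a₁ a₂)ᶜ) -
                prob p (restrictTo (side₁ ends V₁) ⁻¹' connEvent ends a₂ b ∩ restrictTo (side₁ ends V₁) ⁻¹' (connEvent ends a₁ a₂)ᶜ) * prob p (restrictTo (side₁ ends V₁) ⁻¹' connEvent ends a₁ u ∩ restrictTo (side₁ ends V₁) ⁻¹' (connEvent ends a₁ a₂)ᶜ)) -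
            prob p (restrictTo (side₁ ends V₁) ⁻¹' (connEvent ends a₁ a₂)ᶜ) *
              (prob p (restrictTo (side₁ ends V₁) ⁻¹' (connEvent ends a₁ a₂)ᶜ) * prob p (restrictTo (side₁ ends V₁) ⁻¹' connEvent ends a₂ b ∩ restrictTo (side₁ ends V₁) ⁻¹' connEvent ends a₁ o ∩ restrictTo (side₁ ends V₁) ⁻¹' (connEvent ends a₁ a₂)ᶜ) -
                prob p (restrictTo (side₁ ends V₁) ⁻¹' connEvent ends a₂ b ∩ restrictTo (side₁ ends V₁) ⁻¹' (connEvent ends a₁ a₂)ᶜ) * prob p (restrictTo (side₁ ends V₁) ⁻¹' connEvent ends a₁ o ∩ restrictTo (side₁ ends V₁) ⁻¹' (connEvent ends a₁ a₂)ᶜ)) +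
            (prob p ((restrictTo (side₁ ends V₁) ⁻¹' connEvent ends a₁ u ∪ restrictTo (side₁ ends V₁) ⁻¹' connEvent ends a₂ u) ∩ restrictTo (side₁ ends V₁) ⁻¹' (connEvent ends a₁ a₂)ᶜ) - prob p (restrictTo (side₁ ends V₁) ⁻¹' (connEvent ends a₁ a₂)ᶜ)) *
              (prob p (restrictTo (side₁ ends V₁) ⁻¹' (connEvent ends a₁ a₂)ᶜ) * prob p (restrictTo (side₁ ends V₁) ⁻¹' connEvent ends a₁ b ∩ restrictTo (side₁ ends V₁) ⁻¹' connEvent ends a₂ o ∩ restrictTo (side₁ ends V₁) ⁻¹' (connEvent ends a₁ a₂)ᶜ) - prob p (restrictTo (side₁ ends V₁) ⁻¹' connEvent ends a₁ b ∩ restrictTo (side₁ ends V₁) ⁻¹' (connEvent ends a₁ a₂)ᶜ) * prob p (restrictTo (side₁ ends V₁) ⁻¹' connEvent ends a₂ o ∩ restrictTo (side₁ ends V₁) ⁻¹' (connEvent ends a₁ a₂)ᶜ) +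
                prob p (restrictTo (side₁ ends V₁) ⁻¹' (connEvent ends a₁ a₂)ᶜ) * prob p (restrictTo (side₁ ends V₁) ⁻¹' connEvent ends a₂ b ∩ restrictTo (side₁ ends V₁) ⁻¹' connEvent ends a₁ o ∩ restrictTo (side₁ ends V₁) ⁻¹' (connEvent ends a₁ a₂)ᶜ) - prob p (restrictTo (side₁ ends V₁) ⁻¹' connEvent ends a₂ b ∩ restrictTo (side₁ ends V₁) ⁻¹' (connEvent ends a₁ a₂)ᶜ) * prob p (restrictTo (side₁ ends V₁) ⁻¹' connEvent ends a₁ o ∩ restrictTo (side₁ ends V₁) ⁻¹' (connEvent ends a₁ a₂)ᶜ))) := by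
  classical
  set D := (connEvent ends a₁ a₂)ᶜ with hDdef
  set Lb := connEvent ends a₁ b
  set Hb := connEvent ends a₂ b
  set Lu := connEvent ends a₁ u
  set Hu := connEvent ends a₂ u
  set Lo := connEvent ends a₁ o
  set Ho := connEvent ends a₂ o
  have sLb : ∀ ω ∈ D, ω ∈ Lb ↔ restrictTo (side₁ ends V₁) ω ∈ Lb := fun _ hD => conn_side₁ hs hD (Or.inl rfl) hb
  have sHb : ∀ ω ∈ D, ω ∈ Hb ↔ restrictTo (side₁ ends V₁) ω ∈ Hb := fun _ hD => conn_side₁ hs hD (Or.inr rfl) hb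
  have sLu : ∀ ω ∈ D, ω ∈ Lu ↔ restrictTo (side₁ ends V₁) ω ∈ Lu := fun _ hD => conn_side₁ hs hD (Or.inl rfl) hu
  have sHu : ∀ ω ∈ D, ω ∈ Hu ↔ restrictTo (side₁ ends V₁) ω ∈ Hu := fun _ hD => conn_side₁ hs hD (Or.inr rfl) hu
  have sLo : ∀ ω ∈ D, ω ∈ Lo ↔ restrictTo (side₁ ends V₁) ω ∈ Lo := fun _ hD => conn_side₁ hs hD (Or.inl rfl) ho
  have sHo : ∀ ω ∈ D, ω ∈ Ho ↔ restrictTo (side₁ ends V₁) ω ∈ Ho := fun _ hD => conn_side₁ hs hD (Or.inr rfl) ho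
  have soU := side_union sLo sHo
  have suU := side_union sLu sHu
  -- the factorisation `P(X ∩ Q) = P(r₁⁻¹(X ∩ Q)) · P(r₂⁻¹ Q)` for `X` determined on side 1
  -- (as in `RootPairSepRestrict.lean`)
  have hDω := fun ω => compl_conn_iff_restrict hs (ω := ω)
  have ind : ∀ A B : Set (Config E),
      prob p (restrictTo (side₁ ends V₁) ⁻¹' A ∩ restrictTo (side₁ ends V₁)ᶜ ⁻¹' B) =
        prob p (restrictTo (side₁ ends V₁) ⁻¹' A) * prob p (restrictTo (side₁ ends V₁)ᶜ ⁻¹' B) :=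
    fun A B => prob_inter_eq_mul_of_dependsOn p disjoint_compl_right
      (dependsOn_restrictTo _ A) (dependsOn_restrictTo _ B)
  have fac : ∀ X : Set (Config E), (∀ ω ∈ D, ω ∈ X ↔ restrictTo (side₁ ends V₁) ω ∈ X) →
      prob p (X ∩ D) = prob p (restrictTo (side₁ ends V₁) ⁻¹' (X ∩ D)) *
        prob p (restrictTo (side₁ ends V₁)ᶜ ⁻¹' D) := by
    intro X hX
    have e : X ∩ D = restrictTo (side₁ ends V₁) ⁻¹' (X ∩ D) ∩
        restrictTo (side₁ ends V₁)ᶜ ⁻¹' D := by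
      ext ω
      have := hDω ω; have := hX ω
      simp only [Set.mem_inter_iff, Set.mem_preimage]
      tauto
    exact (congrArg (prob p) e).trans (ind _ _)
  have F0 : prob p D = prob p (restrictTo (side₁ ends V₁) ⁻¹' D) *
      prob p (restrictTo (side₁ ends V₁)ᶜ ⁻¹' D) := by
    have h := fac Set.univ (fun _ _ => by simp only [Set.mem_univ])
    simpa only [Set.univ_inter] using h
  have F1 := fac (Lb ∩ Hu ∩ (Lo ∪ Ho)) (side_inter (side_inter sLb sHu) soU)
  have F2 := fac Lb sLb
  have F3 := fac (Hu ∩ (Lo ∪ Ho)) (side_inter sHu soU)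
  have F4 := fac (Lo ∪ Ho) soU
  have F5 := fac (Lb ∩ Hu) (side_inter sLb sHu)
  have F6 := fac Hu sHu
  have F7 := fac (Lb ∩ Ho) (side_inter sLb sHo)
  have F8 := fac Ho sHo
  have G1 := fac (Hb ∩ Lu ∩ (Lo ∪ Ho)) (side_inter (side_inter sHb sLu) soU)
  have G2 := fac Hb sHb
  have G3 := fac (Lu ∩ (Lo ∪ Ho)) (side_inter sLu soU)
  have G5 := fac (Hb ∩ Lu) (side_inter sHb sLu)
  have G6 := fac Lu sLu
  have G7 := fac (Hb ∩ Lo) (side_inter sHb sLo)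
  have G8 := fac Lo sLo
  have U1 := fac (Lu ∪ Hu) suU
  rw [F0, F1, F2, F3, F4, F5, F6, F7, F8, G1, G2, G3, G5, G6, G7, G8, U1]
  simp only [Set.preimage_inter, Set.preimage_union]
  ring

end Main

end RootPairSep

end Summit.Ventures.PercRepro2
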